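import Literature.AlgebraicGeometry.Resolution.BlowupSequencesAppend
import Literature.AlgebraicGeometry.Resolution.BlowupsEquivariant
import HarnessLib

/-!
# Self-induced blow-up sequences: stable centres, lifted actions on every stage, stable strict transforms (Kollár 2007, §3.4.1)

Topic: `Literature/AlgebraicGeometry/Resolution`. Theorems only (no definition, no named fact). Companion
of `EquivariantOrderReduction.lean` (the lift to the TOP of a blow-up sequence `s` with `s = σ^* s`) and of
`BlowupsEquivariant.lean` (one blow-up in a stable centre, Görtz–Wedhorn I, Prop. 13.91 (1)).

J. Kollár, *Lectures on Resolution of Singularities* (2007), §3.4.1 (p. 121): «Functoriality of resolutions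
implies that any group action on `X` lifts to `X′`.» For a blow-up SEQUENCE `s = (Z_0; Z_1; …)` on `X`
(the tree's `CentreSeq X`, chosen blow-ups) the functoriality package 3.34.1 delivers the equation
`s = σ^* s` (`CentreSeq.comap`) for an automorphism `σ` of the datum; this file unpacks that equation
STAGE BY STAGE, which is the form the extraction of a resolution from a principalization (Kollár 3.35 ⟹
3.36, «the first centre containing the strict transform») consumes:

* `CentreSeq.centre_stable_of_cons_eq_comap` — **peeling**: if `(Z_0; rest) = σ^*(Z_0; rest)` then the
  first centre is stable, `σ^* Z_0 = Z_0`, and `rest = τ^* rest` for a morphism `τ : Bl_{Z_0} X → Bl_{Z_0} X`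
  over `σ` (the relation `CentreSeq.IsPullbackAlong` and its uniqueness, BGMW Thm. 8.0.5);
* `CentreSeq.eq_comap_liftAut_of_cons_eq_comap`, `…liftAction…` — the same with `τ` THE lift
  `IsBlowup.liftAut σ` / `IsBlowup.liftAction ρ` of `BlowupsEquivariant.lean` (uniqueness of morphisms
  into a blow-up), so that the peeling iterates along a group action;
* `preimage_strictTransformStep_eq` — a lift `τ` over `σ` of a `σ`-stable subset `Y ⊆ X` to the blow-up of
  a `σ`-stable centre `Z` maps the strict transform `closure (π⁻¹(Y ∖ Z))` onto itself;
* `CentreSeq.exists_lift_preimage_strictTransform_eq`, `CentreSeq.preimage_strictTransform_eq_of_lift` —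
  along the whole sequence: the (unique) lift of `σ` to the top of `s` maps the iterated strict transform
  `s.strictTransform Y` (`BlowupSequences.lean`, GW (13.19)) of a `σ`-stable `Y` onto itself.

Route note: brick «B1.5» of the Kollár-free deck family (P-3′) for route `HodgeConjecture/Q8SymplecticPowers`
(crux K1Q, stmt-HodgeConjecture-24190); general blow-up plumbing, nothing here bears on HC.

## References

* [Kollar2007] J. Kollár, Lectures on Resolution of Singularities (2007), §3.4.1 (p. 121), 3.34.1 (p. 131).
* [GortzWedhorn2020] U. Görtz, T. Wedhorn, Algebraic Geometry I (2nd ed.), (13.19), Prop. 13.91 (1), p. 414.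
* [BierstoneGrigorievMilmanWlodarczyk2011] E. Bierstone, D. Grigoriev, P. Milman, J. Włodarczyk, Effective
  Hironaka resolution and its complexity, Asian J. Math. 15 (2011), Thm. 8.0.5 (1)–(2).
-/

noncomputable section

open CategoryTheory CategoryTheory.Limits AlgebraicGeometry TopologicalSpace

namespace Literature.AlgebraicGeometry.Resolution

universe u

variable {X : Scheme.{u}}

/-! ## One blow-up: the strict transform of a stable subset is stable under a lift -/

/-- **A lift `τ` over `σ` to the blow-up of a `σ`-stable centre `Z` maps the strict transform of a
`σ`-stable subset onto itself**: with `σ⁻¹ Z = Z` (as ideal sheaves), `σ⁻¹ Y = Y` and `τ ∘ π = π ∘ σ`,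
`τ` an isomorphism, `τ⁻¹(closure (π⁻¹(Y ∖ V(Z)))) = closure (π⁻¹(Y ∖ V(Z)))` (the strict transform as the
closure of the preimage off the centre, GW (13.19)). [cite: GortzWedhorn2020, (13.19) and Prop. 13.91 (1) (p. 414)] -/
theorem preimage_strictTransformStep_eq {C : X.IdealSheafData} (σ : X ⟶ X) (hC : C.comap σ = C)
    {X' : Scheme.{u}} (π : X' ⟶ X) {τ : X' ⟶ X'} [IsIso τ] (hτ : τ ≫ π = π ≫ σ) {Y : Set X}
    (hY : σ ⁻¹' Y = Y) :
    τ ⁻¹' closure (π ⁻¹' (Y \ (C.support : Set X))) = closure (π ⁻¹' (Y \ (C.support : Set X))) := by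
  -- the centre's support is `σ`-stable
  have hS : σ ⁻¹' (C.support : Set X) = C.support := by
    have h := congrArg (fun Z : Closeds X => (Z : Set X)) (Scheme.IdealSheafData.support_comap C σ)
    simp only [hC, Closeds.coe_preimage] at h
    exact h.symm
  -- `τ⁻¹ π⁻¹ = π⁻¹ σ⁻¹`
  have hcomp : τ ⁻¹' (π ⁻¹' (Y \ (C.support : Set X))) = π ⁻¹' (Y \ (C.support : Set X)) := by
    rw [← Set.preimage_comp]
    have : (π : X' → X) ∘ (τ : X' → X') = (σ : X → X) ∘ (π : X' → X) := by
      ext x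
      change (τ ≫ π) x = (π ≫ σ) x
      rw [hτ]
    rw [this, Set.preimage_comp, Set.preimage_sdiff, hY, hS]
  change τ.homeomorph ⁻¹' closure (π ⁻¹' (Y \ (C.support : Set X))) = _
  rw [τ.homeomorph.preimage_closure]
  congr 1

namespace CentreSeq

/-! ## Peeling a self-induced sequence -/

/-- **Peeling.** If the sequence `(Z_0; rest)` on `X` is induced from itself along `σ : X ⟶ X`
(`cons C rest = (cons C rest).comap σ`), then the first centre is `σ`-stable (`σ^* Z_0 = Z_0`) and the
tail is induced from itself along a morphism `τ` of the first blow-up lying over `σ`.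
[cite: BierstoneGrigorievMilmanWlodarczyk2011, Thm. 8.0.5 (1)–(2)] -/
theorem centre_stable_of_cons_eq_comap {C : X.IdealSheafData} {rest : CentreSeq (blowup C)}
    (σ : X ⟶ X) (h : cons C rest = (cons C rest).comap σ) :
    C.comap σ = C ∧
      ∃ τ : blowup C ⟶ blowup C, τ ≫ blowup.π C = blowup.π C ≫ σ ∧ rest = rest.comap τ := by
  have hP : IsPullbackAlong σ (cons C rest) (cons C rest) := by
    have hc := isPullbackAlong_comap (cons C rest) σ
    rw [← h] at hc
    exact hc
  obtain ⟨hC, τ, hτ, hrest⟩ := (isPullbackAlong_cons_cons σ C rest C rest).mp hP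
  exact ⟨hC.symm, τ, hτ, hrest.eq_comap⟩

/-- Peeling with THE lifted automorphism of `BlowupsEquivariant.lean`: if `(Z_0; rest) = σ^*(Z_0; rest)`
for `σ ∈ Aut X`, then `σ^* Z_0 = Z_0` and `rest = (σ♯)^* rest` for the lift `σ♯ = IsBlowup.liftAut σ` of
`σ` to `Bl_{Z_0} X`. [cite: GortzWedhorn2020, Prop. 13.91 (1) (p. 414)] -/
theorem eq_comap_liftAut_of_cons_eq_comap {C : X.IdealSheafData} {rest : CentreSeq (blowup C)}
    (σ : Aut X) (h : cons C rest = (cons C rest).comap σ.hom) :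
    ∃ hC : C.comap σ.hom = C, rest = rest.comap ((blowup.isBlowup C).liftAut σ hC).hom := by
  obtain ⟨hC, τ, hτ, hrest⟩ := centre_stable_of_cons_eq_comap σ.hom h
  refine ⟨hC, ?_⟩
  rw [← (blowup.isBlowup C).liftAut_unique σ hC hτ]
  exact hrest

/-- Peeling along a GROUP ACTION: if `(Z_0; rest) = (ρ g)^*(Z_0; rest)` for all `g`, then `Z_0` is
`ρ`-stable and `rest` is induced from itself along the lifted action `IsBlowup.liftAction ρ` on
`Bl_{Z_0} X` — so the peeling iterates. [cite: Kollar2007, §3.4.1 (p. 121)] -/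
theorem eq_comap_liftAction_of_cons_eq_comap {G : Type*} [Group G] {C : X.IdealSheafData}
    {rest : CentreSeq (blowup C)} (ρ : G →* Aut X)
    (h : ∀ g : G, cons C rest = (cons C rest).comap (ρ g).hom) :
    ∃ hC : ∀ g : G, C.comap (ρ g).hom = C,
      ∀ g : G, rest = rest.comap ((blowup.isBlowup C).liftAction ρ hC g).hom := by
  refine ⟨fun g => (centre_stable_of_cons_eq_comap (ρ g).hom (h g)).1, fun g => ?_⟩
  rw [IsBlowup.liftAction_apply]
  obtain ⟨hC, hrest⟩ := eq_comap_liftAut_of_cons_eq_comap (ρ g) (h g)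
  exact hrest

/-! ## The whole sequence: lifts preserve the iterated strict transform -/

/-- **Along a self-induced sequence `s = σ^* s` (`σ` an isomorphism), `σ` lifts to an automorphism of the
top of `s` over `σ` which maps the iterated strict transform `s.strictTransform Y` of every `σ`-stable
subset `Y ⊆ X` onto itself** (induction on `s`, peeling one stable centre at a time).
[cite: Kollar2007, §3.4.1 (p. 121)] -/
theorem exists_lift_preimage_strictTransform_eq :
    ∀ {X : Scheme.{u}} (s : CentreSeq X) (σ : X ⟶ X) [IsIso σ], s = s.comap σ →
      ∀ Y : Set X, σ ⁻¹' Y = Y →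
        ∃ e : s.top ≅ s.top, e.hom ≫ s.comp = s.comp ≫ σ ∧
          e.hom ⁻¹' s.strictTransform Y = s.strictTransform Y
  | X, nil _, σ, hσ, _, Y, hY => ⟨@asIso _ _ _ _ σ hσ, by simp, hY⟩
  | _, cons C rest, σ, hσ, h, Y, hY => by
    haveI := hσ
    obtain ⟨hC, τ, hτ, hrest⟩ := centre_stable_of_cons_eq_comap σ h
    -- `τ` is an isomorphism: it is the lift of the automorphism `asIso σ`
    have hτeq : τ = ((blowup.isBlowup C).liftAut (asIso σ) hC).hom :=
      (blowup.isBlowup C).liftAut_unique (asIso σ) hC hτ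
    haveI : IsIso τ := by rw [hτeq]; infer_instance
    have hY₁ := preimage_strictTransformStep_eq σ hC (blowup.π C) hτ hY
    obtain ⟨e, he, heY⟩ := exists_lift_preimage_strictTransform_eq rest τ hrest _ hY₁
    refine ⟨e, ?_, heY⟩
    change e.hom ≫ rest.comp ≫ blowup.π C = (rest.comp ≫ blowup.π C) ≫ σ
    rw [← Category.assoc, he, Category.assoc, hτ, Category.assoc]

/-- **Any flat lift of `σ` to the top of a self-induced sequence `s = σ^* s` maps the iterated strict
transform of a `σ`-stable subset onto itself** (lifts are unique, `CentreSeq.hom_ext_of_flat`; applies to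
the lifted group actions of `EquivariantOrderReduction.lean`). [cite: Kollar2007, §3.4.1 (p. 121)] -/
theorem preimage_strictTransform_eq_of_lift (s : CentreSeq X) (σ : X ⟶ X) [IsIso σ] (h : s = s.comap σ)
    {φ : s.top ⟶ s.top} [Flat φ] (hφ : φ ≫ s.comp = s.comp ≫ σ) {Y : Set X} (hY : σ ⁻¹' Y = Y) :
    φ ⁻¹' s.strictTransform Y = s.strictTransform Y := by
  obtain ⟨e, he, heY⟩ := s.exists_lift_preimage_strictTransform_eq σ h Y hY
  have : φ = e.hom := s.hom_ext_of_flat (hφ.trans he.symm)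
  rw [this]
  exact heY

/-- The group form: **for an action `ρ` with `s = (ρ g)^* s` for all `g` and ANY action `ρ'` on the top
of `s` making `s.comp` equivariant, every `ρ' g` maps the iterated strict transform of a `ρ`-stable subset
onto itself.** [cite: Kollar2007, §3.4.1 (p. 121)] -/
theorem preimage_strictTransform_eq_of_action {G : Type*} [Group G] (s : CentreSeq X) (ρ : G →* Aut X)
    (h : ∀ g : G, s = s.comap (ρ g).hom) (ρ' : G →* Aut s.top)
    (hρ' : ∀ g : G, (ρ' g).hom ≫ s.comp = s.comp ≫ (ρ g).hom) {Y : Set X}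
    (hY : ∀ g : G, (ρ g).hom ⁻¹' Y = Y) (g : G) :
    (ρ' g).hom ⁻¹' s.strictTransform Y = s.strictTransform Y :=
  s.preimage_strictTransform_eq_of_lift (ρ g).hom (h g) (hρ' g) (hY g)

end CentreSeq

end Literature.AlgebraicGeometry.Resolution

end
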